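import Summits.Langlands.Langlands.Theses.EisensteinDegreeShift
import Summits.Langlands.Langlands.Theorems.RamifiedCoefficientSeedSectorComplementJunctionOfR
import HarnessLib

/-!
# `EisensteinDegreeShift.SectorComplement` is sandwiched by the item `ReciprocityUpToIrreducibilityR`
(stmt-Langlands-17925) granted Jacquet–Shalika (2.2)–(2.3) — item-level certificate
(crux stmt-Langlands-18372, line lead prover-line-stmt-Langlands-18372-0, 2026-08-17; `--supports` file:
no `sorry`, no new definition, axioms `propext` / `Classical.choice` / `Quot.sound`)

`SectorComplement := BorelFLReciprocity → _root_.Langlands` is the declared RESIDUAL JUNCTION (frame item,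
rank 9, "never staffed from this route") of route `EisensteinDegreeShift`: the rest of `GL_n` reciprocity
beyond the residually-Borel Fontaine–Laffaille sector over CM fields.  This file records, on EXISTING named
items and facts, where the junction's open content lives (R by text, JS by name):

* R  := the TEXT of item stmt-Langlands-17925 `IrreducibilityBySelfDuality.ReciprocityUpToIrreducibilityR`
  (reciprocity up to irreducibility for every pinned reciprocity datum, with the non-vacuity conjunct: the
  summit minus irreducibility and uniqueness-up-to-conjugacy in clause (A)), written out verbatim because the
  decl lives in another route's Theses module whose farm olean predates it (same device as the sibling
  certificates `RamifiedCoefficientSeedSectorComplementJunctionOfR`, `PhantomRMYoshidaPhantomRMJunctionOfR`);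
* JS := the Literature named facts `JacquetShalika1981_partialPairL_boundary_repData` (Jacquet–Shalika 1981 II
  Thm. 4.4 / Arthur–Clozel Ch. 3 (2.2); verbatim item stmt-Langlands-13622) and
  `JacquetShalika1981_partialPairL_pole_repData` ((2.3); verbatim item stmt-Langlands-19093).

Theorems (all one-liners on landed material — the engine `JS → R-text → Langlands` is the landed
`RamifiedCoefficientSeedJunctionOfR.langlands_of_reciprocityUpToIrreducibilityR_text_of_JS`, itself a
re-elaboration of `SectorComplementSeam.…` p147356; nothing is re-proved here):
* `sectorComplement_of_reciprocityUpToIrreducibilityR_of_JS` — SUFFICIENCY: JS (2.2) → JS (2.3) → R → C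
  (the sector hypothesis X is discarded: R ∧ JS is already the summit);
* `reciprocityUpToIrreducibilityR_of_sectorComplement_of_target` — NECESSITY under the target X: X → C → R;
* `reciprocityUpToIrreducibilityR_of_sectorComplement_of_cruxes` — necessity under the route's three content
  items S1 S2 S3 (through the route's sorry-free `closes`);
* `sectorComplement_iff_reciprocityUpToIrreducibilityR` — hence, granted JS and X, `C ↔ R`: the crux is
  EXACTLY item stmt-Langlands-17925 modulo two printed theorems and the route target — the machine-readable
  form of this lead's `blocked-on` / HOLD verdict.

What is NOT here: the pure position lemmas (`¬C ↔ X ∧ ¬Langlands`, `Langlands ↔ X ∧ C`, `(C → Langlands) ↔ X`)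
— kernel-checked in `Cruxes/SectorComplement/{Rattack,Position}_EisensteinDegreeShift.lean` and
`Disproof.lean` PART IV and reserved for the disprover's Negative-lane file; no statement of another file is
restated.

References: H. Jacquet, J. Shalika, *On Euler products and the classification of automorphic forms II*,
Amer. J. Math. 103 (1981), Thm. 4.4; K. Buzzard, T. Gee, *The conjectural connections between automorphic
representations and Galois representations* (2014), Conj. 3.2.1–3.2.2; P. Deligne, J.-P. Serre, ASENS 7
(1974), Lemme 3.2.
-/

noncomputable section

-- `Summit.Langlands.Langlands.…` (summit = sub-problem name, D-0017 layout) trips `dupNamespace`.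
set_option linter.dupNamespace false

open Literature.NumberTheory.Automorphic
open Summit.Langlands
open Summit.Langlands.Langlands.Theses.EisensteinDegreeShift
open Summit.Langlands.Langlands.Theorems.RamifiedCoefficientSeedJunctionOfR
  (langlands_of_reciprocityUpToIrreducibilityR_text_of_JS reciprocityUpToIrreducibilityR_text_of_langlands)

namespace Summit.Langlands.Langlands.Theorems.EisensteinDegreeShiftSectorComplement

/-! ## §1 Sufficiency: R and JS give the junction (indeed the summit) -/

/-- **SUFFICIENCY.**  Jacquet–Shalika (2.2) and (2.3) and item stmt-Langlands-17925
(the text of `ReciprocityUpToIrreducibilityR`) imply `EisensteinDegreeShift.SectorComplement`; the antecedent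
`BorelFLReciprocity` is not used (R ∧ JS is the summit, by the landed
`langlands_of_reciprocityUpToIrreducibilityR_text_of_JS`).
[cite: JacquetShalikaAJM1981II, Thm. 4.4] [cite: BuzzardGeeLMS2014, Conj. 3.2.1 and Conj. 3.2.2] -/
theorem sectorComplement_of_reciprocityUpToIrreducibilityR_of_JS
    (h22 : JacquetShalika1981_partialPairL_boundary_repData)
    (h23 : JacquetShalika1981_partialPairL_pole_repData)
    (hR : ∀ (F : Type) [Field F] [NumberField F], Nonempty (ReciprocityData F) ∧
      ∀ (Rec : ReciprocityData F) (n : ℕ), 0 < n →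
        ∀ hcpt : Literature.NumberTheory.Automorphic.isCompact_glFiniteIntegralLevel n F,
          (∀ π : Literature.NumberTheory.Automorphic.CuspidalAutomorphicRepData n F hcpt, π.1.IsLAlgebraic →
            ∀ (ℓ : ℕ) [Fact ℓ.Prime] (ι : PadicAlgCl ℓ ≃+* ℂ),
              ∃ ρ : Literature.NumberTheory.GaloisRepresentations.FramedGaloisRep F (PadicAlgCl ℓ) n,
                IsGeometricFramed Rec ρ ∧ Corresponds Rec ι π.1 ρ) ∧ GaloisToAutomorphic n Rec hcpt) :
    SectorComplement :=
  fun _ => langlands_of_reciprocityUpToIrreducibilityR_text_of_JS h22 h23 hR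

/-! ## §2 Necessity: under the target (or the route's content items) the junction yields R -/

/-- **NECESSITY under the route target**: granted `BorelFLReciprocity`, the junction yields the summit and
hence item stmt-Langlands-17925 (`Langlands → R` is the landed
`reciprocityUpToIrreducibilityR_text_of_langlands`). [folklore] -/
theorem reciprocityUpToIrreducibilityR_of_sectorComplement_of_target (hX : BorelFLReciprocity)
    (hC : SectorComplement) :
    ∀ (F : Type) [Field F] [NumberField F], Nonempty (ReciprocityData F) ∧
      ∀ (Rec : ReciprocityData F) (n : ℕ), 0 < n →
        ∀ hcpt : Literature.NumberTheory.Automorphic.isCompact_glFiniteIntegralLevel n F,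
          (∀ π : Literature.NumberTheory.Automorphic.CuspidalAutomorphicRepData n F hcpt, π.1.IsLAlgebraic →
            ∀ (ℓ : ℕ) [Fact ℓ.Prime] (ι : PadicAlgCl ℓ ≃+* ℂ),
              ∃ ρ : Literature.NumberTheory.GaloisRepresentations.FramedGaloisRep F (PadicAlgCl ℓ) n,
                IsGeometricFramed Rec ρ ∧ Corresponds Rec ι π.1 ρ) ∧ GaloisToAutomorphic n Rec hcpt :=
  reciprocityUpToIrreducibilityR_text_of_langlands (hC hX)

/-- **NECESSITY under the route's three content items** (`EisensteinSteinbergSeed`,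
`EisensteinSeededLifting`, `SolubleDescentGLn`): with them the junction yields the summit through the
route's own sorry-free deciding theorem `closes`, hence item stmt-Langlands-17925. [folklore] -/
theorem reciprocityUpToIrreducibilityR_of_sectorComplement_of_cruxes (h₁ : EisensteinSteinbergSeed)
    (h₂ : EisensteinSeededLifting) (h₃ : SolubleDescentGLn) (hC : SectorComplement) :
    ∀ (F : Type) [Field F] [NumberField F], Nonempty (ReciprocityData F) ∧
      ∀ (Rec : ReciprocityData F) (n : ℕ), 0 < n →
        ∀ hcpt : Literature.NumberTheory.Automorphic.isCompact_glFiniteIntegralLevel n F,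
          (∀ π : Literature.NumberTheory.Automorphic.CuspidalAutomorphicRepData n F hcpt, π.1.IsLAlgebraic →
            ∀ (ℓ : ℕ) [Fact ℓ.Prime] (ι : PadicAlgCl ℓ ≃+* ℂ),
              ∃ ρ : Literature.NumberTheory.GaloisRepresentations.FramedGaloisRep F (PadicAlgCl ℓ) n,
                IsGeometricFramed Rec ρ ∧ Corresponds Rec ι π.1 ρ) ∧ GaloisToAutomorphic n Rec hcpt :=
  reciprocityUpToIrreducibilityR_text_of_langlands (closes h₁ h₂ h₃ hC)

/-! ## §3 The sandwich: granted JS and the target, the junction IS item stmt-Langlands-17925 -/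

/-- **`C ↔ R` granted Jacquet–Shalika (2.2)–(2.3) and the route target.**  The residual junction of route
`EisensteinDegreeShift` is exactly item stmt-Langlands-17925 modulo two printed theorems and
`BorelFLReciprocity` — it can close only together with that item. [folklore] -/
theorem sectorComplement_iff_reciprocityUpToIrreducibilityR
    (h22 : JacquetShalika1981_partialPairL_boundary_repData)
    (h23 : JacquetShalika1981_partialPairL_pole_repData) (hX : BorelFLReciprocity) :
    SectorComplement ↔
      (∀ (F : Type) [Field F] [NumberField F], Nonempty (ReciprocityData F) ∧
      ∀ (Rec : ReciprocityData F) (n : ℕ), 0 < n →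
        ∀ hcpt : Literature.NumberTheory.Automorphic.isCompact_glFiniteIntegralLevel n F,
          (∀ π : Literature.NumberTheory.Automorphic.CuspidalAutomorphicRepData n F hcpt, π.1.IsLAlgebraic →
            ∀ (ℓ : ℕ) [Fact ℓ.Prime] (ι : PadicAlgCl ℓ ≃+* ℂ),
              ∃ ρ : Literature.NumberTheory.GaloisRepresentations.FramedGaloisRep F (PadicAlgCl ℓ) n,
                IsGeometricFramed Rec ρ ∧ Corresponds Rec ι π.1 ρ) ∧ GaloisToAutomorphic n Rec hcpt) :=
  ⟨reciprocityUpToIrreducibilityR_of_sectorComplement_of_target hX,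
    sectorComplement_of_reciprocityUpToIrreducibilityR_of_JS h22 h23⟩

/-- … and the same granted the route's content items instead of the target. [folklore] -/
theorem sectorComplement_iff_reciprocityUpToIrreducibilityR_of_cruxes
    (h22 : JacquetShalika1981_partialPairL_boundary_repData)
    (h23 : JacquetShalika1981_partialPairL_pole_repData) (h₁ : EisensteinSteinbergSeed)
    (h₂ : EisensteinSeededLifting) (h₃ : SolubleDescentGLn) :
    SectorComplement ↔
      (∀ (F : Type) [Field F] [NumberField F], Nonempty (ReciprocityData F) ∧
      ∀ (Rec : ReciprocityData F) (n : ℕ), 0 < n →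
        ∀ hcpt : Literature.NumberTheory.Automorphic.isCompact_glFiniteIntegralLevel n F,
          (∀ π : Literature.NumberTheory.Automorphic.CuspidalAutomorphicRepData n F hcpt, π.1.IsLAlgebraic →
            ∀ (ℓ : ℕ) [Fact ℓ.Prime] (ι : PadicAlgCl ℓ ≃+* ℂ),
              ∃ ρ : Literature.NumberTheory.GaloisRepresentations.FramedGaloisRep F (PadicAlgCl ℓ) n,
                IsGeometricFramed Rec ρ ∧ Corresponds Rec ι π.1 ρ) ∧ GaloisToAutomorphic n Rec hcpt) :=
  ⟨reciprocityUpToIrreducibilityR_of_sectorComplement_of_cruxes h₁ h₂ h₃,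
    sectorComplement_of_reciprocityUpToIrreducibilityR_of_JS h22 h23⟩

end Summit.Langlands.Langlands.Theorems.EisensteinDegreeShiftSectorComplement

end
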